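import Literature.IUT.HodgeTheaters.InitialThetaDataTorsionCuspModelDelta
import HarnessLib

/-!
# [IUTchI] §1 / Ex 4.4 (iv) at the group-ring two-step model: the elements `⟨(u,1),(σ,1)⟩` of
# `Π_{C_F} = (𝔽_l[E_F[l]] ⋊ E_F[l]) ⋊ (G_F × {±1})`, their conjugates, and the SUPPORT-SIZE INVARIANT of subgroups
# (NV-L5 row «EVALSECT-NV/A WITNESS@regeom₃», part 1 of 2: model algebra; definitions)

S. Mochizuki, *Inter-universal Teichmüller theory I*, kurims manuscript (May 2020), Example 4.4 (iv) p. 107 l. 9–12 «each of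
these labels can only be well-defined up to multiplication by ±1 … Also, we observe that these labels depend only on the
third of the three steps of the group-theoretic algorithm of (i), i.e., the step involving [SemiAnbd], Theorem 6.8, (iii)»,
Example 4.4 (i) p. 106 l. 22–27 «the various sections `G_v → Π_v = Π^tp_{X̲̲_v}` of the natural surjection `Π_v ↠ G_v` that arise
from the evaluation points … each evaluation section has an associated label `∈ |𝔽_l|`», §1 p. 37 l. 47–54 (the inertia groups
of the cusps of `X̲` inside `Δ_X̲`) ([IUTchI] Ex 4.4 (iv) p.107) [claim: Mochizuki2012, status: disputed] (D-0012 claim key;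
series status DISPUTED — definitions and kernel theorems about abc-iut-L5-t8's MODEL `TorsionCuspModel` of the cell's
`π₁`-interface (parts B1–B5a: `InitialThetaDataTorsionCuspModel{,KLevel,Geometry,CuspGalois,Delta}.lean`); nothing of the series is
asserted; no side taken on [IUTchIII] Cor. 3.12).

## WHY (abc-iut-L5-lead gen 7 RULINGS #88 (2): row «EVALSECT-NV/A WITNESS@regeom₃», owner abc-iut-w4-d077 g6; STEP-0 19:14:53Z
## (E1)–(E3), second read abc-iut-L5-t3 g7 (R1)–(R3), criterion `EvalSections.labelRigid_of_invariant` p461978-lineage)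

abc-iut-L5-t3's `EvalSectionBinder δ Gv` (Example 4.4 (i) DATA + (iv) `LabelRigid`) is to be INHABITED at the `l`-cusp model `regeom₃`.
(E1) the sections live over `Gv ≤ G_K`; (E2) `G_K` CENTRALISES the finite `Δ = Del = U ⋊ T` (`outer_eq_one_of_fixesTorsion`), so a section
is `σ ↦ ⟨c(σ), (σ,1)⟩` with `c` a HOMOMORPHISM and torsion-translates of a section coincide with it; (E3) hence label-distinct sections
come from a `ℤ/l`-character `χ` of `Gv` (cyclotomic: `Literature.FieldTheory.Galois.exists_surjective_monoidHom_zmod`, p465974) twisting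
`U`-vectors `w_j` of pairwise distinct SUPPORT SIZE, and `LabelRigid` follows from abc-iut-L5-t3's image criterion with the invariant
«support sizes of the `U`-coordinate vectors occurring in a subgroup».  THIS FILE is the model algebra:

* `uElt u σ := ⟨(u, 1), (σ, 1)⟩`; `uElt_mul_uElt` (a homomorphism in `(u, σ)` over torsion-fixing `σ`); **`conj_uElt`**: for EVERY
  `n = ⟨(u_n, t_n), (ρ, ε)⟩ ∈ Π_{C_F}`, `n · ⟨(u,1),(σ,1)⟩ · n⁻¹ = ⟨(P_n u, 1), (ρσρ⁻¹, 1)⟩` with `P_n = τ_{t_n} ∘ outU(ρ, ε)` (`sperm n`) a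
  SIGNED COORDINATE PERMUTATION of `U = 𝔽_l^{E_F[l]}` independent of `σ`;
* `supp`/`suppCard` (support of a `U`-vector and its size), invariant under `transl`, `outU`, `sperm`, and nonzero powers;
* **`suppInv S := {#supp(u) : ⟨(u,1),(σ,1)⟩ ∈ S, σ ∈ Ker(G_F → GL₂(𝔽_l))}`** and **`suppInv_conj`**: `I(n S n⁻¹) = I(S)` for ALL `n ∈ Π_{C_F}`;
* the COBOUNDARY vectors `cobVec g k := τ_g 𝟙_{B_k} · 𝟙_{B_k}⁻¹ ∈ I_{ℤ·g}·U` (`B_k = {g⁰, g², …, g^{2k−2}}`; abc-iut-L5-t8's `cob g`) with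
  **`suppCard_cobVec`**: `#supp = 2k` for `g` of order `l`, `2k ≤ l`;
* plumbing: `fixesTorsion_one`, `fixesTorsion_conj`, `U.pow_eq_pow_mod`, `expOf χ σ := val(χ σ)` and `natCast_expOf`.
Part 2 (`InitialThetaDataTorsionCuspModelEvalSections.lean`): the sections, the good-place local datum of `regeom₃`, the binder.

HONEST LABEL «[model; `E[l]`-twisted finite shadow `U ⋊ E[l]`; statements about OUR typed binders at a MODEL]»: nothing about the genuine
tempered `π₁` or print's evaluation points; typed ≠ inhabited ≠ discharged; instantiated ≠ endorsed; no side taken on [IUTchIII] Cor. 3.12.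
No instance, no notation.
-/

noncomputable section

namespace Literature.IUT.HodgeTheaters

universe u

namespace TorsionCuspModel

open Literature.AnabelianGeometry.AbsoluteAnabelian Topology TorsionMonodromyModel
open Literature.AnabelianGeometry.EtaleTheta.SettingModel
open scoped WeierstrassCurve.Affine Classical Pointwise

variable {F : Type u} [Field F] {E : WeierstrassCurve F} {Fbar : Type u} [Field Fbar] [Algebra F Fbar] {l : ℕ}

/-! ## §1 The elements `⟨(u, 1), (σ, 1)⟩` and their conjugates -/

/-- The element `⟨(u, 1), (σ, 1)⟩ ∈ Π_{C_F} = (U ⋊ T) ⋊ (G_F × {±1})` with `U`-coordinate vector `u` over `σ ∈ G_F`.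
[cite: Mochizuki2012, IUTchI Def 3.1 (b) p.61] -/
def uElt (u : U E Fbar l) (σ : Fbar ≃ₐ[F] Fbar) : PiC F E Fbar l := ⟨SemidirectProduct.inl u, (σ, 1)⟩

/-- The `Del`-component of `⟨(u,1),(σ,1)⟩`. [cite: Mochizuki2012, IUTchI Def 3.1 (b)(c) p.61–62] -/
@[simp] theorem uElt_left (u : U E Fbar l) (σ : Fbar ≃ₐ[F] Fbar) : (uElt u σ).left = SemidirectProduct.inl u := rfl
/-- The `G_F × {±1}`-component of `⟨(u,1),(σ,1)⟩`. [cite: Mochizuki2012, IUTchI Def 3.1 (b)(c) p.61–62] -/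
@[simp] theorem uElt_right (u : U E Fbar l) (σ : Fbar ≃ₐ[F] Fbar) : (uElt u σ).right = (σ, 1) := rfl

/-- `uElt` is injective in the pair `(u, σ)`. [cite: Mochizuki2012, IUTchI Def 3.1 (b)(c) p.61–62] -/
theorem uElt_inj {u u' : U E Fbar l} {σ σ' : Fbar ≃ₐ[F] Fbar} (h : uElt u σ = uElt u' σ') : u = u' ∧ σ = σ' := by
  have h1 := congrArg SemidirectProduct.left h
  have h2 := congrArg SemidirectProduct.right h
  simp only [uElt_left, uElt_right, Prod.mk.injEq] at h1 h2
  exact ⟨SemidirectProduct.inl_injective h1, h2.1⟩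

/-- `⟨(1,1),(1,1)⟩ = 1`. [cite: Mochizuki2012, IUTchI Def 3.1 (b)(c) p.61–62] -/
@[simp] theorem uElt_one_one : uElt (1 : U E Fbar l) (1 : Fbar ≃ₐ[F] Fbar) = 1 :=
  SemidirectProduct.ext (by rw [uElt_left, map_one, SemidirectProduct.one_left])
    (by rw [uElt_right, SemidirectProduct.one_right]; rfl)

/-- Over `σ` fixing the `l`-torsion the elements multiply coordinatewise: `⟨(u,1),(σ,1)⟩·⟨(u′,1),(τ,1)⟩ = ⟨(uu′,1),(στ,1)⟩`. [cite: Mochizuki2012, IUTchI Def 3.1 (b)(c) p.61–62] -/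
theorem uElt_mul_uElt {σ : Fbar ≃ₐ[F] Fbar} (hσ : FixesTorsion E l σ) (u u' : U E Fbar l) (τ : Fbar ≃ₐ[F] Fbar) :
    uElt u σ * uElt u' τ = uElt (u * u') (σ * τ) := by
  refine SemidirectProduct.ext ?_ ?_
  · rw [SemidirectProduct.mul_left, uElt_left, uElt_right, uElt_left, uElt_left, outer_eq_one_of_fixesTorsion hσ,
      MulAut.one_apply, map_mul]
  · rw [SemidirectProduct.mul_right, uElt_right, uElt_right, uElt_right, Prod.mk_mul_mk, mul_one]

/-- The signed coordinate permutation `P_n := τ_{t_n} ∘ outU(q_n)` attached to `n = ⟨(u_n, t_n), q_n⟩ ∈ Π_{C_F}`. [cite: Mochizuki2012, IUTchI Def 3.1 (b)(c) p.61–62] -/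
def sperm (n : PiC F E Fbar l) (u : U E Fbar l) : U E Fbar l := transl E Fbar l n.left.right (outU E l n.right u)

/-- **Conjugation formula**: for `σ` with `ρσρ⁻¹` fixing the `l`-torsion (`ρ = ` the `G_F`-component of `n`),
`n · ⟨(u,1),(σ,1)⟩ · n⁻¹ = ⟨(P_n u, 1), (ρσρ⁻¹, 1)⟩` — the `U`-vector undergoes a signed coordinate permutation INDEPENDENT of `σ`. [cite: Mochizuki2012, IUTchI Def 3.1 (b)(c) p.61–62] -/
theorem conj_uElt (n : PiC F E Fbar l) (u : U E Fbar l) (σ : Fbar ≃ₐ[F] Fbar)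
    (hσ : FixesTorsion E l (n.right.1 * σ * n.right.1⁻¹)) :
    n * uElt u σ * n⁻¹ = uElt (sperm n u) (n.right.1 * σ * n.right.1⁻¹) := by
  have hright : n.right * (σ, 1) * n.right⁻¹ = (n.right.1 * σ * n.right.1⁻¹, 1) := by
    ext <;> simp
  refine SemidirectProduct.ext ?_ ?_
  · rw [SemidirectProduct.mul_left, SemidirectProduct.mul_left, SemidirectProduct.inv_left,
      SemidirectProduct.mul_right, uElt_left, uElt_right, uElt_left, ← MulAut.mul_apply, ← map_mul,
      show n.right * (σ, 1) * n.right⁻¹ = (n.right.1 * σ * n.right.1⁻¹, 1) from hright,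
      outer_eq_one_of_fixesTorsion hσ, MulAut.one_apply]
    rw [outer_inl, del_conj_inl]
    rfl
  · rw [SemidirectProduct.mul_right, SemidirectProduct.mul_right, SemidirectProduct.inv_right, uElt_right, uElt_right,
      hright]

/-! ## §2 The support size of a `U`-vector -/

section Supp

/-- The support of a `U`-vector `u : E_F[l](F̄) → 𝔽_l`. [cite: Mochizuki2012, IUTchI §1 p.37] -/
def supp (u : U E Fbar l) : Set (Tors E Fbar l) := {Q | Multiplicative.toAdd u Q ≠ 0}

/-- Its size `#supp(u)`. [cite: Mochizuki2012, IUTchI §1 p.37] -/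
def suppCard (u : U E Fbar l) : ℕ := (supp u).ncard

/-- Membership in the support. [cite: Mochizuki2012, IUTchI §1 p.37] -/
@[simp] theorem mem_supp {u : U E Fbar l} {Q : Tors E Fbar l} : Q ∈ supp u ↔ Multiplicative.toAdd u Q ≠ 0 := Iff.rfl

/-- `#supp(1) = 0`. [cite: Mochizuki2012, IUTchI §1 p.37] -/
theorem suppCard_one : suppCard (1 : U E Fbar l) = 0 := by
  have h : supp (1 : U E Fbar l) = ∅ := by
    ext Q
    simp [supp]
  rw [suppCard, h, Set.ncard_empty]

/-- Translations preserve the support size. [cite: Mochizuki2012, IUTchI §1 p.37] -/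
theorem suppCard_transl (t : Tors E Fbar l) (u : U E Fbar l) : suppCard (transl E Fbar l t u) = suppCard u := by
  have h : supp (transl E Fbar l t u) = (fun Q => Q * t⁻¹) ⁻¹' supp u := by
    ext Q; simp [supp]
  rw [suppCard, suppCard, h]
  exact Set.ncard_preimage_of_injective_subset_range (mul_left_injective t⁻¹)
    (fun Q _ => ⟨Q * t, by simp⟩)

variable [Fact l.Prime]

/-- The sign `ε(q) ∈ {±1}` is nonzero in `𝔽_l`. [cite: Mochizuki2012, IUTchI §1 p.37] -/
theorem sgnScalar_ne_zero (q : GalPM F Fbar) : sgnScalar (l := l) q ≠ 0 := fun h => by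
  have h1 := sgnScalar_mul_self (l := l) q
  rw [h, mul_zero] at h1
  exact zero_ne_one h1

/-- The signed Galois permutations `outU q` preserve the support size. [cite: Mochizuki2012, IUTchI §1 p.37] -/
theorem suppCard_outU (q : GalPM F Fbar) (u : U E Fbar l) : suppCard (outU E l q u) = suppCard u := by
  have h : supp (outU E l q u) = (fun Q => (act F E Fbar l q).symm Q) ⁻¹' supp u := by
    ext Q
    simp [supp, sgnScalar_ne_zero]
  rw [suppCard, suppCard, h]
  exact Set.ncard_preimage_of_injective_subset_range (act F E Fbar l q).symm.injective
    (fun Q _ => ⟨act F E Fbar l q Q, by simp⟩)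

/-- Hence every `P_n` preserves the support size. [cite: Mochizuki2012, IUTchI Def 3.1 (b)(c) p.61–62] -/
theorem suppCard_sperm (n : PiC F E Fbar l) (u : U E Fbar l) : suppCard (sperm n u) = suppCard u := by
  rw [sperm, suppCard_transl, suppCard_outU]

/-- Coordinates of a power: `(u^k)(Q) = k · u(Q)`. [cite: Mochizuki2012, IUTchI §1 p.37] -/
theorem toAdd_pow_apply (u : U E Fbar l) (k : ℕ) (Q : Tors E Fbar l) :
    Multiplicative.toAdd (u ^ k) Q = (k : ZMod l) * Multiplicative.toAdd u Q := by
  rw [toAdd_pow, Pi.smul_apply, nsmul_eq_mul]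

/-- Nonzero scalings preserve the support size. [cite: Mochizuki2012, IUTchI §1 p.37] -/
theorem suppCard_pow (u : U E Fbar l) {k : ℕ} (hk : (k : ZMod l) ≠ 0) : suppCard (u ^ k) = suppCard u := by
  have h : supp (u ^ k) = supp u := by
    ext Q
    simp [supp, toAdd_pow_apply, hk]
  rw [suppCard, suppCard, h]

/-- A zero scaling kills the support. [cite: Mochizuki2012, IUTchI §1 p.37] -/
theorem suppCard_pow_of_eq_zero (u : U E Fbar l) {k : ℕ} (hk : (k : ZMod l) = 0) : suppCard (u ^ k) = 0 := by
  have h : supp (u ^ k) = ∅ := by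
    ext Q
    simp [supp, toAdd_pow_apply, hk]
  rw [suppCard, h, Set.ncard_empty]

end Supp

/-! ## §3 The invariant `I(S) := {#supp(u) : ⟨(u,1),(σ,1)⟩ ∈ S, σ ∈ Ker(G_F → GL₂(𝔽_l))}` of subgroups of `Π_{C_F}` -/

section Invariant

/-- Conjugates of torsion-fixing elements fix the torsion (the kernel of the mod-`l` representation is normal). [cite: Mochizuki2012, IUTchI Def 3.1 (b)(c) p.61–62] -/
theorem fixesTorsion_conj {σ : Fbar ≃ₐ[F] Fbar} (hσ : FixesTorsion E l σ) (ρ : Fbar ≃ₐ[F] Fbar) :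
    FixesTorsion E l (ρ * σ * ρ⁻¹) := by
  rw [← mem_ker_torsRep_iff] at hσ ⊢
  exact (MonoidHom.normal_ker (torsRep E Fbar l)).conj_mem σ hσ ρ

variable [Fact l.Prime]

/-- **The invariant**: the set of support sizes of `U`-vectors `u` such that `⟨(u,1),(σ,1)⟩ ∈ S` for some `σ` fixing the `l`-torsion. ([IUTchI] Ex 4.4 (iv) p.107) [claim: Mochizuki2012, status: disputed] -/
def suppInv (S : Subgroup (PiC F E Fbar l)) : Set ℕ :=
  {k | ∃ (u : U E Fbar l) (σ : Fbar ≃ₐ[F] Fbar), FixesTorsion E l σ ∧ uElt u σ ∈ S ∧ suppCard u = k}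

/-- One inclusion of the invariance. ([IUTchI] Ex 4.4 (iv) p.107) [claim: Mochizuki2012, status: disputed] -/
theorem suppInv_conj_subset (S : Subgroup (PiC F E Fbar l)) (n : PiC F E Fbar l) :
    suppInv (MulAut.conj n • S) ⊆ suppInv S := by
  rintro k ⟨u, σ, hσ, hmem, rfl⟩
  rw [Subgroup.mem_pointwise_smul_iff_inv_smul_mem, ← map_inv, MulAut.smul_def, MulAut.conj_apply,
    conj_uElt n⁻¹ u σ (fixesTorsion_conj hσ _)] at hmem
  exact ⟨sperm n⁻¹ u, _, fixesTorsion_conj hσ _, hmem, suppCard_sperm _ _⟩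

/-- **`I` is invariant under conjugation by EVERY element of `Π_{C_F}`** (a fortiori by `N(Π_v̲)`). ([IUTchI] Ex 4.4 (iv) p.107) [claim: Mochizuki2012, status: disputed] -/
theorem suppInv_conj (S : Subgroup (PiC F E Fbar l)) (n : PiC F E Fbar l) : suppInv (MulAut.conj n • S) = suppInv S := by
  refine le_antisymm (suppInv_conj_subset S n) ?_
  have h := suppInv_conj_subset (MulAut.conj n • S) n⁻¹
  rwa [map_inv, inv_smul_smul] at h

end Invariant

/-! ## §4 Coboundary vectors with prescribed support size: `u_k := τ_g 𝟙_B · 𝟙_B⁻¹`, `B = {g⁰, g², …, g^{2k-2}}` -/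

section Vectors

/-- The even powers `B_k := {g^0, g^2, …, g^{2(k-1)}}`. [cite: Mochizuki2012, IUTchI §1 p.37] -/
def evenPows (g : Tors E Fbar l) (k : ℕ) : Finset (Tors E Fbar l) := (Finset.range k).image fun i => g ^ (2 * i)

/-- The indicator vector `𝟙_B ∈ U`. [cite: Mochizuki2012, IUTchI §1 p.37] -/
def indU (B : Finset (Tors E Fbar l)) : U E Fbar l := Multiplicative.ofAdd fun Q => if Q ∈ B then 1 else 0

/-- Coordinates of the indicator vector. [cite: Mochizuki2012, IUTchI §1 p.37] -/
@[simp] theorem toAdd_indU_apply (B : Finset (Tors E Fbar l)) (Q : Tors E Fbar l) :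
    Multiplicative.toAdd (indU B) Q = if Q ∈ B then 1 else 0 := rfl

/-- **The coboundary vector `u_k := τ_g 𝟙_{B_k} · 𝟙_{B_k}⁻¹ = 𝟙_{B_k g} − 𝟙_{B_k}`.** [cite: Mochizuki2012, IUTchI §1 p.37] -/
def cobVec (g : Tors E Fbar l) (k : ℕ) : U E Fbar l := transl E Fbar l g (indU (evenPows g k)) * (indU (evenPows g k))⁻¹

/-- `u_k ∈ I_{ℤ·g} · U` (one generator of the coboundary subgroup). [cite: Mochizuki2012, IUTchI §1 p.37] -/
theorem cobVec_mem_cob (g : Tors E Fbar l) (k : ℕ) : cobVec g k ∈ cob (E := E) (Fbar := Fbar) g :=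
  transl_mul_inv_mem_cob (Subgroup.mem_zpowers g) _

/-- Coordinates of `u_k`: `u_k(Q) = [Q g⁻¹ ∈ B_k] − [Q ∈ B_k]`. [cite: Mochizuki2012, IUTchI §1 p.37] -/
theorem toAdd_cobVec_apply (g : Tors E Fbar l) (k : ℕ) (Q : Tors E Fbar l) :
    Multiplicative.toAdd (cobVec g k) Q =
      (if Q * g⁻¹ ∈ evenPows g k then (1 : ZMod l) else 0) - (if Q ∈ evenPows g k then 1 else 0) := by
  rw [cobVec, U.toAdd_mul_apply, U.toAdd_inv_apply, toAdd_transl_apply, toAdd_indU_apply, toAdd_indU_apply,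
    sub_eq_add_neg]

/-- Membership in `B_k`. [cite: Mochizuki2012, IUTchI §1 p.37] -/
theorem mem_evenPows {g : Tors E Fbar l} {k : ℕ} {Q : Tors E Fbar l} : Q ∈ evenPows g k ↔ ∃ i < k, g ^ (2 * i) = Q := by
  simp [evenPows]

variable [Fact l.Prime]

/-- **Support of `u_k`**: for `g` of order `l` and `2k ≤ l`, `supp(u_k) = {g⁰, g¹, …, g^{2k-1}}`. [cite: Mochizuki2012, IUTchI §1 p.37] -/
theorem supp_cobVec {g : Tors E Fbar l} (hg : orderOf g = l) {k : ℕ} (hk : 2 * k ≤ l) :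
    supp (cobVec g k) = ↑((Finset.range (2 * k)).image fun m => g ^ m) := by
  have hinj : ∀ m < l, ∀ m' < l, g ^ m = g ^ m' → m = m' := fun m hm m' hm' h =>
    pow_injOn_Iio_orderOf (by rw [Set.mem_Iio, hg]; exact hm) (by rw [Set.mem_Iio, hg]; exact hm') h
  ext Q
  rw [mem_supp, toAdd_cobVec_apply, Finset.coe_image, Finset.coe_range, Set.mem_image]
  constructor
  · intro hne
    by_cases h1 : Q * g⁻¹ ∈ evenPows g k
    · obtain ⟨i, hi, hgi⟩ := mem_evenPows.mp h1
      exact ⟨2 * i + 1, by rw [Set.mem_Iio]; omega, by rw [pow_succ, hgi, inv_mul_cancel_right]⟩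
    · by_cases h2 : Q ∈ evenPows g k
      · obtain ⟨i, hi, rfl⟩ := mem_evenPows.mp h2
        exact ⟨2 * i, by rw [Set.mem_Iio]; omega, rfl⟩
      · simp [h1, h2] at hne
  · rintro ⟨m, hm, rfl⟩
    rw [Set.mem_Iio] at hm
    rcases Nat.even_or_odd m with ⟨i, rfl⟩ | ⟨i, rfl⟩
    · have hB : g ^ (i + i) ∈ evenPows g k := mem_evenPows.mpr ⟨i, by omega, by rw [two_mul]⟩
      have hBg : g ^ (i + i) * g⁻¹ ∉ evenPows g k := by
        intro h
        obtain ⟨j, hj, hj'⟩ := mem_evenPows.mp h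
        have h3 : g ^ (2 * j + 1) = g ^ (i + i) := by rw [pow_succ, hj', inv_mul_cancel_right]
        have := hinj _ (by omega) _ (by omega) h3
        omega
      simp [hB, hBg]
    · have hBg : g ^ (2 * i + 1) * g⁻¹ ∈ evenPows g k :=
        mem_evenPows.mpr ⟨i, by omega, by rw [pow_succ, mul_inv_cancel_right]⟩
      have hB : g ^ (2 * i + 1) ∉ evenPows g k := by
        intro h
        obtain ⟨j, hj, hj'⟩ := mem_evenPows.mp h
        have := hinj _ (by omega) _ (by omega) hj'
        omega
      simp [hB, hBg]

/-- **`#supp(u_k) = 2k`** (`g` of order `l`, `2k ≤ l`). [cite: Mochizuki2012, IUTchI §1 p.37] -/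
theorem suppCard_cobVec {g : Tors E Fbar l} (hg : orderOf g = l) {k : ℕ} (hk : 2 * k ≤ l) :
    suppCard (cobVec g k) = 2 * k := by
  rw [suppCard, supp_cobVec hg hk, Set.ncard_coe_finset, Finset.card_image_of_injOn, Finset.card_range]
  intro m hm m' hm' h
  rw [Finset.coe_range, Set.mem_Iio] at hm hm'
  exact pow_injOn_Iio_orderOf (by rw [Set.mem_Iio, hg]; omega) (by rw [Set.mem_Iio, hg]; omega) h

end Vectors

/-! ## §4b Model-level plumbing for the sections -/

section Plumbing

/-- The identity fixes the `l`-torsion. [cite: Mochizuki2012, IUTchI Def 3.1 (b)(c) p.61–62] -/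
theorem fixesTorsion_one : FixesTorsion E l (1 : Fbar ≃ₐ[F] Fbar) :=
  (mem_ker_torsRep_iff (E := E) (Fbar := Fbar) (l := l) 1).mp (one_mem _)

/-- Powers in `U` only depend on the exponent mod `l`. [cite: Mochizuki2012, IUTchI §1 p.37] -/
theorem U.pow_eq_pow_mod [NeZero l] (w : U E Fbar l) (n : ℕ) : w ^ n = w ^ (n % l) := by
  conv_lhs => rw [← Nat.mod_add_div n l, pow_add, pow_mul, U.pow_l, one_pow, mul_one]

variable {Gv : Subgroup (Fbar ≃ₐ[F] Fbar)} (χ : ↥Gv →* Multiplicative (ZMod l))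

/-- The exponent `χ(σ) ∈ {0, …, l-1}` of a `ℤ/l`-character value. ([IUTchI] Ex 4.4 (i) p.106) [claim: Mochizuki2012, status: disputed] -/
def expOf (σ : ↥Gv) : ℕ := (Multiplicative.toAdd (χ σ)).val

/-- `(expOf σ : 𝔽_l) = χ(σ)` (additively). ([IUTchI] Ex 4.4 (i) p.106) [claim: Mochizuki2012, status: disputed] -/
theorem natCast_expOf [NeZero l] (σ : ↥Gv) : (expOf χ σ : ZMod l) = Multiplicative.toAdd (χ σ) := by
  rw [expOf, ZMod.natCast_zmod_val]

end Plumbing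

end TorsionCuspModel

end Literature.IUT.HodgeTheaters

end
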